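import Mathlib.LinearAlgebra.Matrix.MvPolynomial
import Mathlib.LinearAlgebra.Matrix.Trace
import Mathlib.LinearAlgebra.Matrix.Notation
import Mathlib.LinearAlgebra.Matrix.Reindex
import Mathlib.Data.Matrix.Composition
import Mathlib.RingTheory.MvPolynomial.Homogeneous
import Mathlib.Algebra.Group.Semiconj.Units
import HarnessLib

/-!
# The symmetrized matrix multiplication polynomial `sM⟨n⟩(A) = trace(A³)` (CHILO 2018)

Topic `Literature/Computability/AlgebraicComplexity`; definition request
`defn-symmetrizedMatMulPoly` (route `WaringApolarity`, `stmt-MatrixMultiplication-0616` ff.).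

## Content

Chiantini–Hauenstein–Ikenmeyer–Landsberg–Ottaviani [CHILO2018, §1] define the *symmetrized
matrix multiplication tensor* `sM⟨n⟩ ∈ Sym³(Mat_n^∨)`, `sM⟨n⟩(A,B,C) = ½[trace(ABC) + trace(BAC)]`
(their (1.2)), and observe that "considered as a cubic polynomial on `Mat_n`,
`sM⟨n⟩(A) = trace(A³)`" (p. 2). We vendor the **polynomial**:

* `symmetrizedMatMulPoly K m : MvPolynomial (m × m) K` — the trace of the cube of the generic
  matrix `Matrix.mvPolynomialX m m K = (X_{(i,j)})_{i,j}`; for `m = Fin n` this is `sM⟨n⟩`.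

Proved API:

* `symmetrizedMatMulPoly_eq_sum` — `sM = ∑_{i,j,k} X_{ij} X_{jk} X_{ki}`;
* `isHomogeneous_symmetrizedMatMulPoly` — homogeneous of degree `3`
  (and `totalDegree = 3` over a nontrivial `K` with `m` nonempty);
* `aeval_symmetrizedMatMulPoly` / `eval_symmetrizedMatMulPoly` — evaluation at (the entries of)
  a matrix `A` over any `K`-algebra gives `trace (A ^ 3)`;
* `aeval_symmetrizedMatMulPoly_conj`, `symmetrizedMatMulPoly_conj_invariant` — invariance under
  `A ↦ P A P⁻¹`, `P ∈ GL(m)` (pointwise, and as a polynomial identity under the linear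
  substitution `X ↦ P X P⁻¹`);
* `aeval_symmetrizedMatMulPoly_transpose`, `rename_swap_symmetrizedMatMulPoly` — invariance
  under `A ↦ Aᵀ` (pointwise, and `rename Prod.swap sM = sM`);
* the block-matrix identity of [CHILO2018, §2, proof of (1.6), p. 5]: for `n × n` matrices
  `A, B, C` and `X = [[0,0,A],[C,0,0],[0,B,0]]` (`chiloBlockMatrix A B C`, indexed by
  `Fin 3 × m`; `chiloBlockMatrixFin` is the `Fin (3n)`-indexed reindexing),
  `X³ = diag(ABC, CAB, BCA)` (`chiloBlocks_pow_three`, `chiloBlockMatrix_pow_three`) and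
  `trace(X³) = 3 trace(ABC)` (`trace_chiloBlockMatrix_pow_three`,
  `trace_chiloBlockMatrixFin_pow_three`, `eval_symmetrizedMatMulPoly_chiloBlockMatrixFin`).

## Design choices

* The index type `m` is any `Fintype` with decidable equality (`Fin n` for `sM⟨n⟩`); the
  coefficient semiring `K` is arbitrary (`ℂ` in [CHILO2018]).
* Waring rank / border Waring rank of `sM⟨n⟩` are *not* defined here (see the companion
  `WaringRankTrCube.lean`, which works with the polynomial *function* `A ↦ trace (A ^ 3)`;
  `eval_symmetrizedMatMulPoly` is the bridge).

## References

* [CHILO2018] L. Chiantini, J. D. Hauenstein, C. Ikenmeyer, J. M. Landsberg, G. Ottaviani,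
  *Polynomials and the exponent of matrix multiplication*, Bull. LMS 50 (2018) 369–389,
  arXiv:1706.05074; §1 (definition of `sM⟨n⟩`, p. 2), §2 (block matrix, p. 5).
  Bib key `ChiantiniHauensteinIkenmeyerLandsbergOttaviani2018`.
-/

noncomputable section

open scoped BigOperators
open Matrix MvPolynomial

namespace Literature.Computability.AlgebraicComplexity

universe u v w

section Poly

variable (K : Type u) [CommSemiring K] (m : Type v) [Fintype m] [DecidableEq m]

/-- The **symmetrized matrix multiplication polynomial** `sM⟨m⟩ := trace (X ^ 3)`, where
`X = Matrix.mvPolynomialX m m K` is the generic `m × m` matrix with entries the variables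
`X (i, j)`; a cubic form in the `m × m` variables. For `m = Fin n` this is CHILO's `sM⟨n⟩`,
"considered as a cubic polynomial on `Mat_n`, `sM⟨n⟩(A) = trace(A³)`".
[cite: ChiantiniHauensteinIkenmeyerLandsbergOttaviani2018, §1 (p. 2)] -/
def symmetrizedMatMulPoly : MvPolynomial (m × m) K :=
  ((mvPolynomialX m m K) ^ 3).trace

/-- Unfolding lemma. [folklore] -/
theorem symmetrizedMatMulPoly_def :
    symmetrizedMatMulPoly K m = ((mvPolynomialX m m K) ^ 3).trace := rfl

/-- `sM = ∑_{i,j,k} X_{ij} X_{jk} X_{ki}`. [folklore] -/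
theorem symmetrizedMatMulPoly_eq_sum :
    symmetrizedMatMulPoly K m = ∑ i : m, ∑ j : m, ∑ k : m, X (i, j) * X (j, k) * X (k, i) := by
  rw [symmetrizedMatMulPoly, pow_three', trace]
  refine Finset.sum_congr rfl fun i _ => ?_
  rw [diag_apply, mul_apply, Finset.sum_comm]
  refine Finset.sum_congr rfl fun j _ => ?_
  rw [mul_apply, Finset.sum_mul]
  rfl

/-- `sM⟨m⟩` is a homogeneous cubic. [folklore] -/
theorem isHomogeneous_symmetrizedMatMulPoly : (symmetrizedMatMulPoly K m).IsHomogeneous 3 := by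
  rw [symmetrizedMatMulPoly_eq_sum]
  refine IsHomogeneous.sum _ _ _ fun i _ => IsHomogeneous.sum _ _ _ fun j _ =>
    IsHomogeneous.sum _ _ _ fun k _ => ?_
  exact ((isHomogeneous_X K _).mul (isHomogeneous_X K _)).mul (isHomogeneous_X K _)

/-- `sM⟨m⟩ ∈ Sym³`, i.e. lies in the degree-`3` homogeneous component. [folklore] -/
theorem symmetrizedMatMulPoly_mem_homogeneousSubmodule :
    symmetrizedMatMulPoly K m ∈ homogeneousSubmodule (m × m) K 3 :=
  isHomogeneous_symmetrizedMatMulPoly K m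

variable {K m}
variable {S : Type w} [CommSemiring S] [Algebra K S]

/-- **Evaluation formula**: substituting the entries of a matrix `A` (over any `K`-algebra) for
the variables gives `trace (A ^ 3)`.
[cite: ChiantiniHauensteinIkenmeyerLandsbergOttaviani2018, §1 (p. 2)] -/
theorem aeval_symmetrizedMatMulPoly (A : Matrix m m S) :
    aeval (fun p : m × m => A p.1 p.2) (symmetrizedMatMulPoly K m) = (A ^ 3).trace := by
  conv_rhs => rw [← mvPolynomialX_mapMatrix_aeval K A]
  rw [← map_pow, AlgHom.mapMatrix_apply, symmetrizedMatMulPoly]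
  exact AddMonoidHom.map_trace _ _

/-- Evaluation formula over `K` itself: `eval A sM = trace (A ^ 3)`. [folklore] -/
theorem eval_symmetrizedMatMulPoly (A : Matrix m m K) :
    eval (fun p : m × m => A p.1 p.2) (symmetrizedMatMulPoly K m) = (A ^ 3).trace := by
  rw [← coe_aeval_eq_eval]
  exact aeval_symmetrizedMatMulPoly A

/-- Substituting the generic matrix itself is the identity. [folklore] -/
theorem aeval_mvPolynomialX_symmetrizedMatMulPoly :
    aeval (fun p : m × m => mvPolynomialX m m K p.1 p.2) (symmetrizedMatMulPoly K m) =
      symmetrizedMatMulPoly K m :=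
  aeval_X_left_apply _

/-- **`GL`-conjugation invariance** (pointwise): `sM(P A P⁻¹) = sM(A)`. [folklore] -/
theorem aeval_symmetrizedMatMulPoly_conj (P : (Matrix m m S)ˣ) (A : Matrix m m S) :
    aeval (fun p : m × m => ((P : Matrix m m S) * A * (↑P⁻¹ : Matrix m m S)) p.1 p.2)
        (symmetrizedMatMulPoly K m) =
      aeval (fun p : m × m => A p.1 p.2) (symmetrizedMatMulPoly K m) := by
  rw [aeval_symmetrizedMatMulPoly, aeval_symmetrizedMatMulPoly, Units.conj_pow, trace_units_conj]

/-- **`GL`-conjugation invariance** (as a polynomial identity): the linear substitution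
`X ↦ P X P⁻¹`, for any invertible `P` (over `K`, or even over the polynomial ring), fixes `sM`.
[folklore] -/
theorem symmetrizedMatMulPoly_conj_invariant (P : (Matrix m m (MvPolynomial (m × m) K))ˣ) :
    aeval (fun p : m × m =>
        ((P : Matrix m m (MvPolynomial (m × m) K)) * mvPolynomialX m m K *
          (↑P⁻¹ : Matrix m m (MvPolynomial (m × m) K))) p.1 p.2)
        (symmetrizedMatMulPoly K m) = symmetrizedMatMulPoly K m := by
  rw [aeval_symmetrizedMatMulPoly_conj, aeval_mvPolynomialX_symmetrizedMatMulPoly]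

/-- **`GL_m(K)`-conjugation invariance** (as a polynomial identity): for `P ∈ GL_m(K)` the
linear substitution `X ↦ P X P⁻¹` fixes `sM`. [folklore] -/
theorem symmetrizedMatMulPoly_conj_invariant' (P : (Matrix m m K)ˣ) :
    aeval (fun p : m × m =>
        (((P : Matrix m m K).map (C : K → MvPolynomial (m × m) K)) * mvPolynomialX m m K *
          (↑P⁻¹ : Matrix m m K).map (C : K → MvPolynomial (m × m) K)) p.1 p.2)
        (symmetrizedMatMulPoly K m) = symmetrizedMatMulPoly K m := by
  have h := symmetrizedMatMulPoly_conj_invariant (K := K) (m := m)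
    (Units.map (RingHom.mapMatrix (C : K →+* MvPolynomial (m × m) K)).toMonoidHom P)
  simp only [Units.coe_map, Units.coe_map_inv, RingHom.toMonoidHom_eq_coe, MonoidHom.coe_coe,
    RingHom.mapMatrix_apply] at h
  exact h

/-- **Transpose invariance** (pointwise): `sM(Aᵀ) = sM(A)`. [folklore] -/
theorem aeval_symmetrizedMatMulPoly_transpose (A : Matrix m m S) :
    aeval (fun p : m × m => Aᵀ p.1 p.2) (symmetrizedMatMulPoly K m) =
      aeval (fun p : m × m => A p.1 p.2) (symmetrizedMatMulPoly K m) := by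
  rw [aeval_symmetrizedMatMulPoly, aeval_symmetrizedMatMulPoly, ← transpose_pow, trace_transpose]

/-- **Transpose invariance** (as a polynomial identity): renaming `X (i, j) ↦ X (j, i)` fixes
`sM`. [folklore] -/
theorem rename_swap_symmetrizedMatMulPoly :
    rename Prod.swap (symmetrizedMatMulPoly K m) = symmetrizedMatMulPoly K m := by
  rw [rename_eq_aeval]
  change aeval (fun p : m × m => (mvPolynomialX m m K)ᵀ p.1 p.2) (symmetrizedMatMulPoly K m) = _
  rw [aeval_symmetrizedMatMulPoly_transpose, aeval_mvPolynomialX_symmetrizedMatMulPoly]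

/-- `sM ≠ 0` as soon as there is at least one variable and `K` is nontrivial (evaluate at the
elementary matrix `E_{ii}`). [folklore] -/
theorem symmetrizedMatMulPoly_ne_zero [Nonempty m] [Nontrivial K] :
    symmetrizedMatMulPoly K m ≠ 0 := by
  obtain ⟨i⟩ := ‹Nonempty m›
  intro h
  have h1 := eval_symmetrizedMatMulPoly (K := K) (Matrix.single i i (1 : K))
  rw [h, map_zero, pow_three', single_mul_single_same, single_mul_single_same, mul_one, mul_one,
    trace_single_eq_same] at h1
  exact zero_ne_one h1

/-- Over a nontrivial `K` with `m` nonempty, `sM` has total degree exactly `3`. [folklore] -/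
theorem totalDegree_symmetrizedMatMulPoly [Nonempty m] [Nontrivial K] :
    (symmetrizedMatMulPoly K m).totalDegree = 3 :=
  (isHomogeneous_symmetrizedMatMulPoly K m).totalDegree symmetrizedMatMulPoly_ne_zero

end Poly

/-! ## The block matrix `X(A, B, C)` of [CHILO2018, p. 5] -/

section Block

variable {R : Type u} {m : Type v}

/-- The `3 × 3` block pattern `[[0, 0, A], [C, 0, 0], [0, B, 0]]` (as a matrix of matrices).
[cite: ChiantiniHauensteinIkenmeyerLandsbergOttaviani2018, §2 (proof of (1.6), p. 5)] -/
def chiloBlocks [Zero R] (A B C : Matrix m m R) : Matrix (Fin 3) (Fin 3) (Matrix m m R) :=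
  !![0, 0, A; C, 0, 0; 0, B, 0]

/-- CHILO's `3n × 3n` matrix `X = X(A, B, C) = [[0, 0, A], [C, 0, 0], [0, B, 0]]`, indexed by
`Fin 3 × m` (block index first).
[cite: ChiantiniHauensteinIkenmeyerLandsbergOttaviani2018, §2 (proof of (1.6), p. 5)] -/
def chiloBlockMatrix [Zero R] (A B C : Matrix m m R) : Matrix (Fin 3 × m) (Fin 3 × m) R :=
  Matrix.comp (Fin 3) (Fin 3) m m R (chiloBlocks A B C)

/-- Entry formula for the block matrix. [folklore] -/
@[simp]
theorem chiloBlockMatrix_apply [Zero R] (A B C : Matrix m m R) (p q : Fin 3 × m) :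
    chiloBlockMatrix A B C p q = chiloBlocks A B C p.1 q.1 p.2 q.2 := rfl

variable [Fintype m]

/-- Trace of a block matrix is the sum of the traces of the diagonal blocks. [folklore] -/
theorem trace_comp {I : Type w} [Fintype I] [AddCommMonoid R] (M : Matrix I I (Matrix m m R)) :
    trace (Matrix.comp I I m m R M) = ∑ i, trace (M i i) := by
  simp only [trace, diag_apply, comp_apply]
  exact Fintype.sum_prod_type _

/-- Trace is invariant under reindexing. [folklore] -/
theorem trace_reindex {n : Type w} [Fintype n] [AddCommMonoid R] (e : m ≃ n) (M : Matrix m m R) :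
    trace (reindex e e M) = trace M := by
  simp only [trace, diag_apply, reindex_apply, submatrix_apply]
  exact e.symm.sum_comp (fun i => M i i)

variable [DecidableEq m] [CommSemiring R]

/-- `X³ = diag(ABC, CAB, BCA)` at the level of blocks.
[cite: ChiantiniHauensteinIkenmeyerLandsbergOttaviani2018, §2 (proof of (1.6), p. 5)] -/
theorem chiloBlocks_pow_three (A B C : Matrix m m R) :
    chiloBlocks A B C ^ 3 = !![A * B * C, 0, 0; 0, C * A * B, 0; 0, 0, B * C * A] := by
  rw [pow_three', chiloBlocks, mul_fin_three, mul_fin_three]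
  simp [Matrix.mul_assoc]

/-- `X(A,B,C)³ = diag(ABC, CAB, BCA)`.
[cite: ChiantiniHauensteinIkenmeyerLandsbergOttaviani2018, §2 (proof of (1.6), p. 5)] -/
theorem chiloBlockMatrix_pow_three (A B C : Matrix m m R) :
    chiloBlockMatrix A B C ^ 3 =
      Matrix.comp (Fin 3) (Fin 3) m m R !![A * B * C, 0, 0; 0, C * A * B, 0; 0, 0, B * C * A] := by
  rw [chiloBlockMatrix, ← compRingEquiv_apply, ← map_pow, chiloBlocks_pow_three, compRingEquiv_apply]

/-- `trace (X(A,B,C)³) = 3 trace(ABC)`.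
[cite: ChiantiniHauensteinIkenmeyerLandsbergOttaviani2018, §2 (proof of (1.6), p. 5)] -/
theorem trace_chiloBlockMatrix_pow_three (A B C : Matrix m m R) :
    trace (chiloBlockMatrix A B C ^ 3) = 3 * trace (A * B * C) := by
  rw [chiloBlockMatrix_pow_three, trace_comp, Fin.sum_univ_three]
  simp only [of_apply, cons_val', cons_val_zero, cons_val_one, cons_val_fin_one, empty_val',
    cons_val_two, Nat.succ_eq_add_one, Nat.reduceAdd, tail_cons, head_cons, head_fin_const]
  rw [← trace_mul_cycle A B C, trace_mul_cycle B C A]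
  ring

/-- CHILO's block matrix `X(A, B, C)` as a `Fin (3 n) × Fin (3 n)` matrix (block `I`, row `i`
sits at index `I * n + i`… precisely, via `finProdFinEquiv : Fin 3 × Fin n ≃ Fin (3 * n)`).
[cite: ChiantiniHauensteinIkenmeyerLandsbergOttaviani2018, §2 (proof of (1.6), p. 5)] -/
def chiloBlockMatrixFin {n : ℕ} (A B C : Matrix (Fin n) (Fin n) R) :
    Matrix (Fin (3 * n)) (Fin (3 * n)) R :=
  reindex finProdFinEquiv finProdFinEquiv (chiloBlockMatrix A B C)

/-- `trace (X(A,B,C)³) = 3 trace(ABC)` for the `Fin (3n)`-indexed block matrix.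
[cite: ChiantiniHauensteinIkenmeyerLandsbergOttaviani2018, §2 (proof of (1.6), p. 5)] -/
theorem trace_chiloBlockMatrixFin_pow_three {n : ℕ} (A B C : Matrix (Fin n) (Fin n) R) :
    trace (chiloBlockMatrixFin A B C ^ 3) = 3 * trace (A * B * C) := by
  rw [chiloBlockMatrixFin, ← coe_reindexAlgEquiv R, ← map_pow, coe_reindexAlgEquiv, trace_reindex,
    trace_chiloBlockMatrix_pow_three]

/-- `sM⟨3n⟩(X(A,B,C)) = 3 trace(ABC)`: the symmetrized matrix multiplication polynomial of size
`3n` restricts to (three times) the matrix multiplication tensor `⟨n,n,n⟩`.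
[cite: ChiantiniHauensteinIkenmeyerLandsbergOttaviani2018, §2 (proof of (1.6), p. 5)] -/
theorem eval_symmetrizedMatMulPoly_chiloBlockMatrixFin {n : ℕ} (A B C : Matrix (Fin n) (Fin n) R) :
    eval (fun p => chiloBlockMatrixFin A B C p.1 p.2) (symmetrizedMatMulPoly R (Fin (3 * n))) =
      3 * trace (A * B * C) := by
  rw [eval_symmetrizedMatMulPoly, trace_chiloBlockMatrixFin_pow_three]

end Block

end Literature.Computability.AlgebraicComplexity
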